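import Literature.Analysis.FluidPDE.OseenSliceLSixBound
import Literature.Analysis.FluidPDE.TypeIAncientMild
import Literature.Analysis.FluidPDE.NSBoundedMildOseenRestart
import Literature.Analysis.UnboundedOperators.HeatExtensionDecay
import Literature.Analysis.UnboundedOperators.HeatKernelGaussianData
import Literature.Analysis.UnboundedOperators.HeatKernelBoundedData
import Literature.Analysis.UnboundedOperators.HeatKernelHeatEquation
import Summits.NavierStokesRegularity.NavierStokesRegularity.Theorems.LerayQuarterDissipationFiniteDissipationLiouvilleStubSmallDissipationGap
import HarnessLib

/-!
# Route `LerayQuarterDissipation`, crux `FiniteDissipationLiouville` (stmt-NavierStokesRegularity-22144)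
  — structure of the finite-dissipation stratum: every slice lies in `L⁶(ℝ³)` (file 1/2: tools)

`--supports stmt-NavierStokesRegularity-22144` (helper). The route, its critic, its refuter and the
crux's disprover all use that a Type-I ancient mild field `w` in the KNSS gauge with Leray's
quarter-rate dissipation law `∫‖∇w(s)‖² ≤ K/√(−s)` has slices in `L⁶(ℝ³)` ("`Ḣ¹ ⊂ L⁶`"), e.g. to
make the Caffarelli–Kohn–Nirenberg / Albritton–Barker machinery legal on the stratum and to feed
Chae–Wolf 2017 Thm 1.1 (`p = 6`) on its DSS members. Sobolev's inequality only gives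
`w(t) − c_t ∈ L⁶` for SOME constant vector `c_t` (`Ḣ¹ ∩ L^∞ ⊂ L⁶ + constants`, tree
`exists_const_sub_lsix_le`); these two files prove that **the gauge kills the constant**: `c_t = 0`, so

  `w(t) ∈ L⁶(ℝ³)` and `(∫‖w(t)‖⁶)^{1/6} ≤ C_S √(K⁺/√(−t))` for every `t < 0`   (`memLp_six_slice`,
file 2/2). THIS file supplies the two analytic tools: `norm_heatExtension_le_rpow_mul_lsix`
(`|e^{τΔ}g(x)| ≤ τ^{-1/4}‖g‖₆`) and `norm_heatExtension_oseenDuhamel_le` (the heat flow of the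
Duhamel term is `O(τ^{-3/4})` on the stratum).

**Proof.** Fix `t < 0`, let `c = c_t`, `g = w(t) − c`. Apply the heat flow `e^{τΔ}` (`τ > 0`) at a
point to the Oseen identity `w(t) = e^{(t−s)Δ}w(s) − B_s(w,w)(t)` (`s < t`): by the semigroup law
and the restart formula for the Duhamel term (tree `heatExtension_oseenDuhamel_eq_setIntegral`,
applied to the field frozen after time `t`),
`c + e^{τΔ}g(x) = e^{(τ+t−s)Δ}w(s)(x) − ∫_s^t∫ K(t+τ−σ, x−y)[w(σ,y), w(σ,y)] dy dσ`.
The first term on the right is `≤ C/√(−s)` (Type I, heat flow an `L^∞` contraction); each slice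
of the second is `≤ C₆ (t+τ−σ)^{-3/4} · C/√(−σ) · ‖w(σ) − c_σ‖₆ ≤ C₆ C C_S √(K⁺) (−t)^{-3/4} τ^{-3/4}`
by the `L^∞ × L⁶` slice bound of the Oseen kernel (`exists_norm_integral_oseenKernel_le_lsix`,
zero mean of the kernel) and Sobolev modulo constants at time `σ`; and
`|e^{τΔ}g(x)| ≤ ‖G_τ‖_{6/5}‖g‖₆ ≤ (4πτ)^{-1/4}‖g‖₆`. Letting `τ → ∞` and then `s → −∞` gives
`c = 0`. Nothing here bears on Navier–Stokes regularity; no summit is proved.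
-/

noncomputable section

open Set MeasureTheory Filter Topology Function Metric Real
open Literature.Analysis Literature.Analysis.FluidPDE Literature.Analysis.UnboundedOperators
open scoped ENNReal NNReal

namespace Summit.NavierStokesRegularity.NavierStokesRegularity.Theorems.FiniteDissipationLiouville.Birth

-- the problem-side namespace duplicates `NavierStokesRegularity` by design (summit = problem)
set_option linter.dupNamespace false

/-! ### Gaussian integrability of bounded data -/

/-- Bounded a.e.-strongly measurable data are integrable against every centred Gaussian. -/
theorem integrable_heatKernel_mul_norm_of_bound
    {f : EuclideanSpace ℝ (Fin 3) → EuclideanSpace ℝ (Fin 3)} (hf : AEStronglyMeasurable f volume)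
    {M : ℝ} (hM : ∀ y, ‖f y‖ ≤ M) (a : ℝ) (ha : 0 < a) :
    Integrable (fun y => heatKernel a y * ‖f y‖) volume :=
  (integrable_heatKernel_holds ha).mul_bdd hf.norm
    (Eventually.of_forall fun y => by rw [norm_norm]; exact hM y)

/-- The convolution integrand of `e^{aΔ}f(x)` is integrable for bounded measurable `f`. -/
theorem integrable_heatKernel_smul_sub_of_bound
    {f : EuclideanSpace ℝ (Fin 3) → EuclideanSpace ℝ (Fin 3)} (hf : AEStronglyMeasurable f volume)
    {M : ℝ} (hM : ∀ y, ‖f y‖ ≤ M) {a : ℝ} (ha : 0 < a) (x : EuclideanSpace ℝ (Fin 3)) :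
    Integrable (fun y => heatKernel a y • f (x - y)) volume :=
  integrable_heatKernel_smul_sub hf (fun b hb => integrable_heatKernel_mul_norm_of_bound hf hM b hb)
    ha x

/-! ### The heat flow of an `L⁶` field is small at large times -/

/-- **`|e^{τΔ}g(x)| ≤ τ^{-1/4} ‖g‖₆` on `ℝ³`** for a continuous bounded `g ∈ L⁶` (Hölder `(6/5, 6)`
and `‖G_τ‖_{6/5} ≤ (sup G_τ)^{1/6} ≤ (4πτ)^{-1/4} ≤ τ^{-1/4}`). -/
theorem norm_heatExtension_le_rpow_mul_lsix
    {g : EuclideanSpace ℝ (Fin 3) → EuclideanSpace ℝ (Fin 3)}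
    (hmem : MemLp g 6 volume) {τ : ℝ} (hτ : 0 < τ) (x : EuclideanSpace ℝ (Fin 3)) :
    ‖heatExtension g τ x‖ ≤ τ ^ (-(1 / 4 : ℝ)) * (∫ y, ‖g y‖ ^ (6 : ℝ)) ^ (1 / 6 : ℝ) := by
  -- the prefactor `M = (4πτ)^{-3/2}` dominates the kernel
  set M : ℝ := (4 * π * τ) ^ (-((Module.finrank ℝ (EuclideanSpace ℝ (Fin 3)) : ℝ)) / 2) with hMdef
  have hM0 : 0 < M := by rw [hMdef]; positivity
  have hGle : ∀ y, heatKernel τ y ≤ M := fun y => by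
    show (4 * π * τ) ^ (-((Module.finrank ℝ (EuclideanSpace ℝ (Fin 3)) : ℝ)) / 2) *
        Real.exp (-‖y‖ ^ 2 / (4 * τ)) ≤ M
    refine mul_le_of_le_one_right hM0.le ?_
    rw [Real.exp_le_one_iff, neg_div]
    exact neg_nonpos.2 (by positivity)
  -- the translated kernel `φ(y) = G_τ(x - y)`
  set φ : EuclideanSpace ℝ (Fin 3) → ℝ := fun y => heatKernel τ (x - y) with hφ
  have hφ0 : ∀ y, 0 ≤ φ y := fun y => (heatKernel_pos hτ _).le
  have hφc : Continuous φ := (continuous_heatKernel τ).comp (continuous_const.sub continuous_id)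
  have hφi : Integrable φ volume := (integrable_heatKernel_holds hτ).comp_sub_left x
  have hφint : ∫ y, φ y = 1 := by
    have h := integral_sub_left_eq_self (heatKernel (E := EuclideanSpace ℝ (Fin 3)) τ) volume x
    simp only [hφ]
    rw [h]
    exact integral_heatKernel_eq_one_holds hτ
  -- `φ^{6/5} ≤ M^{1/5} φ`, so `φ ∈ L^{6/5}` with `∫ φ^{6/5} ≤ M^{1/5}`
  have hpow : ∀ y, φ y ^ (6 / 5 : ℝ) ≤ M ^ (1 / 5 : ℝ) * φ y := by
    intro y
    have h1 : φ y ^ (6 / 5 : ℝ) = φ y ^ (1 / 5 : ℝ) * φ y := by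
      rw [show (6 / 5 : ℝ) = (1 / 5 : ℝ) + 1 by norm_num, Real.rpow_add_one' (hφ0 y) (by norm_num),
        mul_comm]
    rw [h1]
    exact mul_le_mul_of_nonneg_right (Real.rpow_le_rpow (hφ0 y) (hGle _) (by norm_num)) (hφ0 y)
  have hφmem : MemLp φ (ENNReal.ofReal (6 / 5)) volume := by
    refine (integrable_norm_rpow_iff hφc.aestronglyMeasurable (by norm_num) ENNReal.ofReal_ne_top).1 ?_
    have h65 : (ENNReal.ofReal (6 / 5)).toReal = 6 / 5 := ENNReal.toReal_ofReal (by norm_num)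
    refine (hφi.const_mul (M ^ (1 / 5 : ℝ))).mono' ?_ (Eventually.of_forall fun y => ?_)
    · exact (hφc.norm.rpow_const fun y => Or.inr (by norm_num)).aestronglyMeasurable
    · rw [h65, Real.norm_of_nonneg (Real.rpow_nonneg (norm_nonneg _) _),
        Real.norm_of_nonneg (hφ0 y)]
      exact hpow y
  have h6 : ENNReal.ofReal 6 = (6 : ℝ≥0∞) := by norm_num
  have hgn : MemLp (fun y => ‖g y‖) (ENNReal.ofReal 6) volume := by rw [h6]; exact hmem.norm
  have hpq : (6 / 5 : ℝ).HolderConjugate 6 := ⟨by norm_num, by norm_num, by norm_num⟩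
  have hHolder := integral_mul_le_Lp_mul_Lq_of_nonneg hpq (Eventually.of_forall hφ0)
    (Eventually.of_forall fun y => norm_nonneg (g y)) hφmem hgn
  -- `(∫ φ^{6/5})^{5/6} ≤ (M^{1/5})^{5/6} = (4πτ)^{-1/4} ≤ τ^{-1/4}`
  have hI65 : (∫ y, φ y ^ (6 / 5 : ℝ)) ≤ M ^ (1 / 5 : ℝ) := by
    calc (∫ y, φ y ^ (6 / 5 : ℝ)) ≤ ∫ y, M ^ (1 / 5 : ℝ) * φ y :=
          integral_mono_of_nonneg (Eventually.of_forall fun y => Real.rpow_nonneg (hφ0 y) _)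
            (hφi.const_mul _) (Eventually.of_forall hpow)
      _ = M ^ (1 / 5 : ℝ) := by rw [integral_const_mul, hφint, mul_one]
  have hroot : (∫ y, φ y ^ (6 / 5 : ℝ)) ^ (1 / (6 / 5 : ℝ)) ≤ τ ^ (-(1 / 4 : ℝ)) := by
    have hnn : 0 ≤ ∫ y, φ y ^ (6 / 5 : ℝ) := integral_nonneg fun y => Real.rpow_nonneg (hφ0 y) _
    calc (∫ y, φ y ^ (6 / 5 : ℝ)) ^ (1 / (6 / 5 : ℝ))
        ≤ (M ^ (1 / 5 : ℝ)) ^ (1 / (6 / 5 : ℝ)) := Real.rpow_le_rpow hnn hI65 (by norm_num)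
      _ = (4 * π * τ) ^ (-(1 / 4 : ℝ)) := by
          rw [hMdef, finrank_euclideanSpace_fin, ← Real.rpow_mul (by positivity),
            ← Real.rpow_mul (by positivity)]
          norm_num
      _ ≤ τ ^ (-(1 / 4 : ℝ)) := by
          refine Real.rpow_le_rpow_of_nonpos hτ ?_ (by norm_num)
          have : (1 : ℝ) ≤ 4 * π := by nlinarith [Real.pi_gt_three]
          nlinarith
  -- assemble
  have hN0 : 0 ≤ (∫ y, ‖g y‖ ^ (6 : ℝ)) ^ (1 / 6 : ℝ) :=
    Real.rpow_nonneg (integral_nonneg fun y => by positivity) _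
  rw [heatExtension_eq_integral_sub]
  calc ‖∫ y, heatKernel τ (x - y) • g y‖
      ≤ ∫ y, ‖heatKernel τ (x - y) • g y‖ := norm_integral_le_integral_norm _
    _ = ∫ y, φ y * ‖g y‖ := by
        refine integral_congr_ae (Eventually.of_forall fun y => ?_)
        simp only [hφ, norm_smul, Real.norm_of_nonneg (heatKernel_pos hτ _).le]
    _ ≤ (∫ y, φ y ^ (6 / 5 : ℝ)) ^ (1 / (6 / 5 : ℝ)) * (∫ y, ‖g y‖ ^ (6 : ℝ)) ^ (1 / (6 : ℝ)) :=
        hHolder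
    _ ≤ τ ^ (-(1 / 4 : ℝ)) * (∫ y, ‖g y‖ ^ (6 : ℝ)) ^ (1 / 6 : ℝ) := by
        rw [one_div (6 : ℝ)] at *
        exact mul_le_mul_of_nonneg_right hroot (by simpa [one_div] using hN0)

/-! ### The slices of the stratum lie in `L⁶` -/

section Slices

variable {C Kp C₆ CS : ℝ} {w : ℝ → EuclideanSpace ℝ (Fin 3) → EuclideanSpace ℝ (Fin 3)}

/-- **The Duhamel term through the heat flow.** For a Type-I ancient mild field `w` whose slices
`w(σ)`, `σ < 0`, differ from constants `c_σ` (`‖c_σ‖ ≤ C/√(−σ)`) by `L⁶` fields of size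
`≤ C_S √(K⁺/√(−σ))`, and `s < t < 0 < τ`:
`‖e^{τΔ}[B_s(w,w)(t)](0)‖ ≤ (t − s) · C₆ (C/√(−t)) (C_S √(K⁺/√(−t))) τ^{-3/4}` (restart formula for
the field frozen after time `t`, then the `L^∞ × L⁶` slice bound slice by slice). -/
theorem norm_heatExtension_oseenDuhamel_le (hw : IsTypeIAncientMild C w) (hKp0 : 0 ≤ Kp)
    (hC₆ : 0 ≤ C₆)
    (hslice : ∀ {τ : ℝ}, 0 < τ → ∀ (x : EuclideanSpace ℝ (Fin 3))
      {f : EuclideanSpace ℝ (Fin 3) → EuclideanSpace ℝ (Fin 3)}, Continuous f →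
      ∀ {A : ℝ}, (∀ y, ‖f y‖ ≤ A) → ∀ {c : EuclideanSpace ℝ (Fin 3)}, ‖c‖ ≤ A →
      MemLp (fun y => f y - c) 6 volume →
      ‖∫ y, oseenKernel τ (x - y) (f y) (f y)‖ ≤
        C₆ * τ ^ (-(3 / 4 : ℝ)) * A * (∫ y, ‖f y - c‖ ^ (6 : ℝ)) ^ (1 / 6 : ℝ))
    (hCS : 0 ≤ CS)
    (hslab : ∀ σ < 0, ∃ c : EuclideanSpace ℝ (Fin 3), ‖c‖ ≤ C / Real.sqrt (-σ) ∧
      MemLp (fun y => w σ y - c) 6 volume ∧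
      (∫ y, ‖w σ y - c‖ ^ (6 : ℝ)) ^ (1 / 6 : ℝ) ≤ CS * Real.sqrt (Kp / Real.sqrt (-σ)))
    {s t τ : ℝ} (hst : s < t) (ht : t < 0) (hτ : 0 < τ) :
    ‖heatExtension (oseenDuhamel 1 s w w t) τ 0‖ ≤
      (t - s) * (C₆ * (C / Real.sqrt (-t)) * (CS * Real.sqrt (Kp / Real.sqrt (-t))) *
        τ ^ (-(3 / 4 : ℝ))) := by
  have hC0 : 0 ≤ C := hw.nonneg
  have hrt : 0 < Real.sqrt (-t) := Real.sqrt_pos.2 (by linarith)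
  -- the field frozen after time `t`
  set wc : ℝ → EuclideanSpace ℝ (Fin 3) → EuclideanSpace ℝ (Fin 3) := fun σ y => w (min σ t) y
    with hwc
  have hwc_eq : ∀ σ, σ ≤ t → wc σ = w σ := fun σ hσ => by
    funext y; simp [hwc, min_eq_left hσ]
  have hwcb : ∀ σ y, ‖wc σ y‖ ≤ C / Real.sqrt (-t) := by
    intro σ y
    have hm : min σ t < 0 := lt_of_le_of_lt (min_le_right σ t) ht
    refine (hw.norm_le hm y).trans ?_
    exact div_le_div_of_nonneg_left hC0 hrt (Real.sqrt_le_sqrt (by linarith [min_le_right σ t]))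
  have hwcm : Measurable (uncurry wc) := by
    have e : uncurry wc = uncurry w ∘ fun p : ℝ × EuclideanSpace ℝ (Fin 3) => (min p.1 t, p.2) := by
      funext p; rfl
    rw [e]
    refine (hw.continuousOn_uncurry.comp_continuous (by fun_prop) fun p => ?_).measurable
    exact mk_mem_prod (lt_of_le_of_lt (min_le_right _ _) ht) (mem_univ _)
  have hBd_wc : oseenDuhamel 1 s wc wc t = oseenDuhamel 1 s w w t := by
    funext x
    rw [oseenDuhamel_apply, oseenDuhamel_apply]
    refine setIntegral_congr_fun measurableSet_Ioo fun σ hσ => ?_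
    simp only [hwc_eq σ hσ.2.le]
  -- the restart formula
  have hrestart : heatExtension (oseenDuhamel 1 s w w t) τ 0 =
      ∫ σ in Ioo s t, ∫ y, oseenKernel (1 * (t + τ - σ)) (0 - y) (wc σ y) (wc σ y) := by
    have h := heatExtension_oseenDuhamel_eq_setIntegral (w := wc) one_pos hwcm hwcb hst
      (show t < t + τ by linarith) (0 : EuclideanSpace ℝ (Fin 3))
    rw [hBd_wc, show (1 : ℝ) * (t + τ - t) = τ by ring] at h
    exact h
  rw [hrestart]
  -- the uniform slice bound
  set Q : ℝ := C₆ * (C / Real.sqrt (-t)) * (CS * Real.sqrt (Kp / Real.sqrt (-t))) with hQ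
  have hsl : ∀ σ ∈ Ioo s t,
      ‖∫ y, oseenKernel (1 * (t + τ - σ)) (0 - y) (wc σ y) (wc σ y)‖ ≤ Q * τ ^ (-(3 / 4 : ℝ)) := by
    intro σ hσ
    have hσ0 : σ < 0 := hσ.2.trans ht
    have hτ' : 0 < 1 * (t + τ - σ) := by linarith [hσ.2]
    rw [hwc_eq σ hσ.2.le]
    obtain ⟨cσ, hcσ, hmemσ, hNσ⟩ := hslab σ hσ0
    have h1 := hslice hτ' 0 (hw.continuous_slice hσ0) (fun y => hw.norm_le hσ0 y) hcσ hmemσ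
    refine h1.trans ?_
    have hsσ : Real.sqrt (-t) ≤ Real.sqrt (-σ) := Real.sqrt_le_sqrt (by linarith [hσ.2])
    have hA_le : C / Real.sqrt (-σ) ≤ C / Real.sqrt (-t) := div_le_div_of_nonneg_left hC0 hrt hsσ
    have hN_le : (∫ y, ‖w σ y - cσ‖ ^ (6 : ℝ)) ^ (1 / 6 : ℝ) ≤
        CS * Real.sqrt (Kp / Real.sqrt (-t)) :=
      hNσ.trans (mul_le_mul_of_nonneg_left
        (Real.sqrt_le_sqrt (div_le_div_of_nonneg_left hKp0 hrt hsσ)) hCS)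
    have hτle : (1 * (t + τ - σ)) ^ (-(3 / 4 : ℝ)) ≤ τ ^ (-(3 / 4 : ℝ)) :=
      Real.rpow_le_rpow_of_nonpos hτ (by linarith [hσ.2]) (by norm_num)
    have hw0 : 0 ≤ (1 * (t + τ - σ)) ^ (-(3 / 4 : ℝ)) := Real.rpow_nonneg hτ'.le _
    have hτ0 : 0 ≤ τ ^ (-(3 / 4 : ℝ)) := Real.rpow_nonneg hτ.le _
    have hNσ0 : 0 ≤ (∫ y, ‖w σ y - cσ‖ ^ (6 : ℝ)) ^ (1 / 6 : ℝ) :=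
      Real.rpow_nonneg (integral_nonneg fun y => by positivity) _
    have hA0 : 0 ≤ C / Real.sqrt (-σ) := by positivity
    -- monotone replacement of the three variable factors
    have step1 : C₆ * (1 * (t + τ - σ)) ^ (-(3 / 4 : ℝ)) ≤ C₆ * τ ^ (-(3 / 4 : ℝ)) :=
      mul_le_mul_of_nonneg_left hτle hC₆
    have step2 : C₆ * (1 * (t + τ - σ)) ^ (-(3 / 4 : ℝ)) * (C / Real.sqrt (-σ)) ≤
        C₆ * τ ^ (-(3 / 4 : ℝ)) * (C / Real.sqrt (-t)) :=
      mul_le_mul step1 hA_le hA0 (mul_nonneg hC₆ hτ0)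
    have step3 : C₆ * (1 * (t + τ - σ)) ^ (-(3 / 4 : ℝ)) * (C / Real.sqrt (-σ)) *
        (∫ y, ‖w σ y - cσ‖ ^ (6 : ℝ)) ^ (1 / 6 : ℝ) ≤
        C₆ * τ ^ (-(3 / 4 : ℝ)) * (C / Real.sqrt (-t)) * (CS * Real.sqrt (Kp / Real.sqrt (-t))) :=
      mul_le_mul step2 hN_le hNσ0 (mul_nonneg (mul_nonneg hC₆ hτ0) (by positivity))
    calc C₆ * (1 * (t + τ - σ)) ^ (-(3 / 4 : ℝ)) * (C / Real.sqrt (-σ)) *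
          (∫ y, ‖w σ y - cσ‖ ^ (6 : ℝ)) ^ (1 / 6 : ℝ)
        ≤ C₆ * τ ^ (-(3 / 4 : ℝ)) * (C / Real.sqrt (-t)) * (CS * Real.sqrt (Kp / Real.sqrt (-t))) :=
          step3
      _ = Q * τ ^ (-(3 / 4 : ℝ)) := by rw [hQ]; ring
  have hvol : (volume : Measure ℝ).real (Ioo s t) = t - s := by
    rw [Real.volume_real_Ioo, max_eq_left (by linarith)]
  have hIoo : (volume : Measure ℝ) (Ioo s t) < ∞ := measure_Ioo_lt_top
  have h := norm_setIntegral_le_of_norm_le_const hIoo hsl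
  rw [hvol] at h
  calc ‖∫ σ in Ioo s t, ∫ y, oseenKernel (1 * (t + τ - σ)) (0 - y) (wc σ y) (wc σ y)‖
      ≤ Q * τ ^ (-(3 / 4 : ℝ)) * (t - s) := h
    _ = (t - s) * (Q * τ ^ (-(3 / 4 : ℝ))) := by ring

end Slices

end Summit.NavierStokesRegularity.NavierStokesRegularity.Theorems.FiniteDissipationLiouville.Birth

end
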